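import Summits.CriticalPhenomena.PercolationContinuityZ3.Theorems.PercNearOneGluingNoHeavyQuantBlobWalk
import HarnessLib

/-!
# QUANT lane R8 tool: head split of the blob-walk cdf recursion `CB[a, p, m]` and of the block-comb CROSSING FORM

builds on p205010 (kernel theorem, internal audit signed; external expert review pending)

Support file (`--supports stmt-CriticalPhenomena-4575`), QUANT lane typer seat prim-quant-stmt (gen 14); pure algebra on the explicit
recursion of `…QuantBlobWalk.lean` (lead g10, LEAD-NOTES-G10 N21), used by `…QuantBlockCombCount.lean` (same seat: the count law on a
block-comb, tree side of N21 (1)).  No probability space; no definitions (the `local notation3` of `…QuantBlobWalk.lean`, verbatim), no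
sorries, standard axioms.

* `Quant.BlobWalk.CB_head` — conditioning on the FIRST blob: `CB[a,p,k+1] s = p 0 · CB[a∘succ,p∘succ,k] (s − a 0) + (1 − p 0) · CB[a∘succ,p∘succ,k] s`
  (the blob analogue of p1 g6's `Quant.CountDP.PB_head`).
* `Quant.BlobWalk.crossing_form_of_neg`, `Quant.BlobWalk.crossing_form_head` — the CROSSING FORM
  `Φ_K(a,p,w,x,c; t) := Σ_{k<K} w k · p k · (CB[k] t − CB[k] (t − a k)) + x · (CB[K] t − CB[K] (t − c))` vanishes for `t < 0` and satisfies
  `Φ_{K+1}(a,p,w; t) = w 0 · p 0 · (CB[0] t − CB[0] (t − a 0)) + p 0 · Φ_K(a∘succ,p∘succ,w∘succ; t − a 0) + (1 − p 0) · Φ_K(a∘succ,p∘succ,w∘succ; t)`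
  — the recursion matched, on the tree side, by removing the top blob of a block-comb.
[folklore] bookkeeping; the setting is [this work] (N21).
-/

noncomputable section

namespace Summit.CriticalPhenomena.PercolationContinuityZ3.Theorems

namespace Quant

open Finset

/-- `CB[a, p, m] t` = probability that the open mass of the first `m` blobs (sizes `a`, gates `p`) is `≤ t` (the recursion of
`…QuantBlobWalk.lean`, verbatim). -/
local notation3 "CB[" a ", " p ", " m "]" =>
  (Nat.rec (motive := fun _ => ℤ → ℝ) (fun t => if (0 : ℤ) ≤ t then (1 : ℝ) else 0)
    (fun n f t => (p : ℕ → ℝ) n * f (t - ((a : ℕ → ℕ) n : ℤ)) + (1 - (p : ℕ → ℝ) n) * f t) (m : ℕ))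


namespace BlobWalk

variable (a : ℕ → ℕ) (p : ℕ → ℝ)

/-- **Head split of the blob-walk cdf.**  Conditioning on the FIRST blob instead of the last:
`CB[a, p, k+1] s = p 0 · CB[a∘succ, p∘succ, k] (s − a 0) + (1 − p 0) · CB[a∘succ, p∘succ, k] s`. [folklore] -/
theorem CB_head (k : ℕ) : ∀ s : ℤ,
    CB[a, p, k + 1] s = p 0 * CB[(fun i => a (i + 1)), (fun i => p (i + 1)), k] (s - (a 0 : ℤ)) +
      (1 - p 0) * CB[(fun i => a (i + 1)), (fun i => p (i + 1)), k] s := by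
  induction k with
  | zero => intro s; rfl
  | succ k ih =>
    intro s
    rw [CB_succ a p (k + 1) s, ih (s - (a (k + 1) : ℤ)), ih s,
      CB_succ (fun i => a (i + 1)) (fun i => p (i + 1)) k (s - (a 0 : ℤ)),
      CB_succ (fun i => a (i + 1)) (fun i => p (i + 1)) k s]
    have e : s - (a (k + 1) : ℤ) - (a 0 : ℤ) = s - (a 0 : ℤ) - (a (k + 1) : ℤ) := by ring
    rw [e]
    ring

/-- The crossing form vanishes below level zero: for `s < 0` every window `CB[k] s − CB[k] (s − a k)` and the terminal window are `0`.
[folklore] -/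
theorem crossing_form_of_neg (w : ℕ → ℝ) (x : ℝ) (K c : ℕ) (s : ℤ) (hs : s < 0) :
    ∑ k ∈ Finset.range K, w k * p k * (CB[a, p, k] s - CB[a, p, k] (s - (a k : ℤ))) +
        x * (CB[a, p, K] s - CB[a, p, K] (s - (c : ℤ))) = 0 := by
  have h1 : ∀ k, CB[a, p, k] s = 0 := fun k => CB_of_neg a p k s hs
  have h2 : ∀ k, CB[a, p, k] (s - (a k : ℤ)) = 0 := fun k =>
    CB_of_neg a p k _ (by have := Int.natCast_nonneg (a k); omega)
  have h3 : CB[a, p, K] (s - (c : ℤ)) = 0 := CB_of_neg a p K _ (by have := Int.natCast_nonneg c; omega)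
  rw [h1 K, h3]
  have : ∑ k ∈ Finset.range K, w k * p k * (CB[a, p, k] s - CB[a, p, k] (s - (a k : ℤ))) = 0 :=
    Finset.sum_eq_zero fun k _ => by rw [h1 k, h2 k]; ring
  rw [this]; ring

/-- **Head split of the crossing form.**  Peeling the top blob `0` off the crossing form of `K+1` blobs:
`Φ_{K+1}(a, p, w; t) = w 0 · p 0 · (CB[0] t − CB[0](t − a 0)) + p 0 · Φ_K(a∘succ, p∘succ, w∘succ; t − a 0) + (1 − p 0) · Φ_K(…; t)`.
[folklore] -/
theorem crossing_form_head (w : ℕ → ℝ) (x : ℝ) (K c : ℕ) (t : ℤ) :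
    ∑ k ∈ Finset.range (K + 1), w k * p k * (CB[a, p, k] t - CB[a, p, k] (t - (a k : ℤ))) +
        x * (CB[a, p, K + 1] t - CB[a, p, K + 1] (t - (c : ℤ))) =
      w 0 * p 0 * (CB[a, p, 0] t - CB[a, p, 0] (t - (a 0 : ℤ))) +
      p 0 * (∑ k ∈ Finset.range K, w (k + 1) * p (k + 1) *
          (CB[(fun i => a (i + 1)), (fun i => p (i + 1)), k] (t - (a 0 : ℤ)) -
            CB[(fun i => a (i + 1)), (fun i => p (i + 1)), k] (t - (a 0 : ℤ) - (a (k + 1) : ℤ))) +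
        x * (CB[(fun i => a (i + 1)), (fun i => p (i + 1)), K] (t - (a 0 : ℤ)) -
          CB[(fun i => a (i + 1)), (fun i => p (i + 1)), K] (t - (a 0 : ℤ) - (c : ℤ)))) +
      (1 - p 0) * (∑ k ∈ Finset.range K, w (k + 1) * p (k + 1) *
          (CB[(fun i => a (i + 1)), (fun i => p (i + 1)), k] t -
            CB[(fun i => a (i + 1)), (fun i => p (i + 1)), k] (t - (a (k + 1) : ℤ))) +
        x * (CB[(fun i => a (i + 1)), (fun i => p (i + 1)), K] t -
          CB[(fun i => a (i + 1)), (fun i => p (i + 1)), K] (t - (c : ℤ)))) := by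
  rw [Finset.sum_range_succ' (fun k => w k * p k * (CB[a, p, k] t - CB[a, p, k] (t - (a k : ℤ))))]
  have hterm : ∀ k ∈ Finset.range K,
      w (k + 1) * p (k + 1) * (CB[a, p, k + 1] t - CB[a, p, k + 1] (t - (a (k + 1) : ℤ))) =
        p 0 * (w (k + 1) * p (k + 1) *
          (CB[(fun i => a (i + 1)), (fun i => p (i + 1)), k] (t - (a 0 : ℤ)) -
            CB[(fun i => a (i + 1)), (fun i => p (i + 1)), k] (t - (a 0 : ℤ) - (a (k + 1) : ℤ)))) +
        (1 - p 0) * (w (k + 1) * p (k + 1) *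
          (CB[(fun i => a (i + 1)), (fun i => p (i + 1)), k] t -
            CB[(fun i => a (i + 1)), (fun i => p (i + 1)), k] (t - (a (k + 1) : ℤ)))) := by
    intro k _
    rw [CB_head a p k t, CB_head a p k (t - (a (k + 1) : ℤ))]
    have e : t - (a (k + 1) : ℤ) - (a 0 : ℤ) = t - (a 0 : ℤ) - (a (k + 1) : ℤ) := by ring
    rw [e]; ring
  rw [Finset.sum_congr rfl hterm, Finset.sum_add_distrib, ← Finset.mul_sum, ← Finset.mul_sum,
    CB_head a p K t, CB_head a p K (t - (c : ℤ))]
  have e : t - (c : ℤ) - (a 0 : ℤ) = t - (a 0 : ℤ) - (c : ℤ) := by ring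
  rw [e]; ring

end BlobWalk

end Quant

end Summit.CriticalPhenomena.PercolationContinuityZ3.Theorems

end
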